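import Mathlib
import Summits.Ventures.PercRepro2.Defs
import Summits.Ventures.PercRepro2.Independence
import Summits.Ventures.PercRepro2.Harris
import Summits.Ventures.PercRepro2.Graph
import Summits.Ventures.PercRepro2.Events
import Summits.Ventures.PercRepro2.ZCClusterBlind
import Summits.Ventures.PercRepro2.ZCRootDecomp
import Summits.Ventures.PercRepro2.ZCCondProb
import Summits.Ventures.PercRepro2.ZCThetaPA
import Summits.Ventures.PercRepro2.CondAvoidPA
import Summits.Ventures.PercRepro2.ZCDirectCube
import Summits.Ventures.PercRepro2.ZCDirectFibre
import Summits.Ventures.PercRepro2.ZCDirectInfluence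
import Summits.Ventures.PercRepro2.ZCDirectFun
import Summits.Ventures.PercRepro2.ZCDirectMain
import Summits.Ventures.PercRepro2.ZCDirectLift

/-!
# `(ZC-direct)` for functions: the theorem `zc_direct_fun` (blind cell PercRepro2, mine-a g29)

The functional form of `zc_direct` (ZCDirectMain.lean): for a MONOTONE observable `u` of the edges of
`a₁` with values in `[0, 1]`, lifted to `U = liftU u : Config E → R` (`U ω = u (ω restricted to the edges
of a₁)`), and the kernel `e = {a₁ ↔ a₃}`, `L = {a₁ ↔ o}`, `γ = {a₃ ↔ o}`, `B = eᶜ ∩ Lᶜ ∩ γ`, `D = eᶜ ∩ Lᶜ ∩ γᶜ`: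

  `P(D)·(E[U 1_{e ∩ L}] − E[U] P(e ∩ L)) − P(B)·(E[U 1_{e ∩ Lᶜ}] − E[U] P(e ∩ Lᶜ)) ≥ 0`.

Same proof as `zc_direct` with `ZCDirectFun`'s functional influence `fIu` in place of `fI` and the cube
step applied to `u` directly.  This is the form needed by the `N`-first split of the cluster-blind event
(MINE-A.md §83.6): its between term is exactly this expression at `u(N) = P(Ũ ∣ N)`.
-/

namespace Summit.Ventures.PercRepro2

namespace ZCDirect

variable {V : Type*} {E : Type*} [Fintype V] [DecidableEq V] [Fintype E] [DecidableEq E]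
  {R : Type*} [Field R] [LinearOrder R] [IsStrictOrderedRing R]

variable (ends : E → Sym2 V) (a₁ : V)

section AssemblyFun

variable (p : E → R)

/-- The observable `Ψ = I(C(a₃))·(S·1_{eᶜ ∩ (γ ∪ L)} − b·1_{eᶜ})`. -/
noncomputable def psiF (u : ({e // e ∉ awayEdges ends a₁} → Bool) → R) (a₃ o : V) (S b : R)
    (ω : Config E) : R :=
  fIu ends a₁ p u a₃ ω *
    (S * ((connEvent ends a₁ a₃)ᶜ ∩ (connEvent ends a₃ o ∪ connEvent ends a₁ o)).indicator 1 ω -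
      b * (connEvent ends a₁ a₃)ᶜ.indicator 1 ω)

omit [LinearOrder R] [IsStrictOrderedRing R] in
/-- The value of `Ψ` along a fibre. -/
lemma psiF_glue (u : ({e // e ∉ awayEdges ends a₁} → Bool) → R) (σ₁ : {e // e ∈ awayEdges ends a₁} → Bool)
    (τ : {e // e ∉ awayEdges ends a₁} → Bool) (a₃ o : V) (S b : R) :
    psiF ends a₁ p u a₃ o S b (glue (awayEdges ends a₁) σ₁ τ) =
      IpropF ends a₁ p u (cluster ends (baseConfig ends a₁ σ₁) a₃) *
        (S * ((fib ends a₁ (connEvent ends a₁ a₃) σ₁)ᶜ ∩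
            (if Conn ends (baseConfig ends a₁ σ₁) a₃ o then Set.univ
              else fib ends a₁ (connEvent ends a₁ o) σ₁)).indicator 1 τ -
          b * (fib ends a₁ (connEvent ends a₁ a₃) σ₁)ᶜ.indicator 1 τ) := by
  classical
  unfold psiF fIu
  by_cases hX : Conn ends (glue (awayEdges ends a₁) σ₁ τ) a₁ a₃
  · -- `a₁ ↔ a₃`: both sides vanish
    have h1 : glue (awayEdges ends a₁) σ₁ τ ∉ (connEvent ends a₁ a₃)ᶜ := fun h => h hX
    have h2 : τ ∉ (fib ends a₁ (connEvent ends a₁ a₃) σ₁)ᶜ := fun h => h hX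
    have h3 : glue (awayEdges ends a₁) σ₁ τ ∉
        (connEvent ends a₁ a₃)ᶜ ∩ (connEvent ends a₃ o ∪ connEvent ends a₁ o) := fun h => h1 h.1
    have h4 : τ ∉ (fib ends a₁ (connEvent ends a₁ a₃) σ₁)ᶜ ∩
        (if Conn ends (baseConfig ends a₁ σ₁) a₃ o then Set.univ
          else fib ends a₁ (connEvent ends a₁ o) σ₁) := fun h => h2 h.1
    rw [Set.indicator_of_notMem h1, Set.indicator_of_notMem h3, Set.indicator_of_notMem h2,
      Set.indicator_of_notMem h4]
    ring
  · have hcl := cluster_eq_base_of_not_conn ends a₁ σ₁ τ hX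
    rw [hcl]
    have h1 : glue (awayEdges ends a₁) σ₁ τ ∈ (connEvent ends a₁ a₃)ᶜ := hX
    have h2 : τ ∈ (fib ends a₁ (connEvent ends a₁ a₃) σ₁)ᶜ := hX
    have key : glue (awayEdges ends a₁) σ₁ τ ∈
        (connEvent ends a₁ a₃)ᶜ ∩ (connEvent ends a₃ o ∪ connEvent ends a₁ o) ↔
        τ ∈ (fib ends a₁ (connEvent ends a₁ a₃) σ₁)ᶜ ∩
          (if Conn ends (baseConfig ends a₁ σ₁) a₃ o then Set.univ
            else fib ends a₁ (connEvent ends a₁ o) σ₁) := by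
      simp only [Set.mem_inter_iff, Set.mem_union, mem_connEvent]
      rw [conn_a3o_of_not_conn ends a₁ σ₁ τ hX]
      constructor
      · rintro ⟨_, hγ | hL⟩
        · exact ⟨h2, by simp [hγ]⟩
        · refine ⟨h2, ?_⟩
          split_ifs
          · trivial
          · exact hL
      · rintro ⟨_, hm⟩
        refine ⟨h1, ?_⟩
        split_ifs at hm with hγ
        · exact Or.inl hγ
        · exact Or.inr hm
    rw [Set.indicator_of_mem h1, Set.indicator_of_mem h2]
    by_cases hk : glue (awayEdges ends a₁) σ₁ τ ∈
        (connEvent ends a₁ a₃)ᶜ ∩ (connEvent ends a₃ o ∪ connEvent ends a₁ o)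
    · rw [Set.indicator_of_mem hk, Set.indicator_of_mem (key.1 hk)]
      simp only [Pi.one_apply]
    · rw [Set.indicator_of_notMem hk, Set.indicator_of_notMem (fun h => hk (key.2 h))]
      simp only [Pi.one_apply]

omit [LinearOrder R] [IsStrictOrderedRing R] in
/-- The fibre expectation of `Ψ`. -/
lemma expect_psiF_fibre (u : ({e // e ∉ awayEdges ends a₁} → Bool) → R) (σ₁ : {e // e ∈ awayEdges ends a₁} → Bool)
    {a₃ o : V} (h3 : a₃ ≠ a₁) (ho : o ≠ a₁) (S b : R) :
    expect (fun i : {e // e ∉ awayEdges ends a₁} => p i)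
        (fun τ => psiF ends a₁ p u a₃ o S b (glue (awayEdges ends a₁) σ₁ τ)) =
      (S * mConst ends a₁ p σ₁ a₃ o - b) *
        prob (fun i : {e // e ∉ awayEdges ends a₁} => p i) (fib ends a₁ (connEvent ends a₁ a₃) σ₁)ᶜ *
          IpropF ends a₁ p u (cluster ends (baseConfig ends a₁ σ₁) a₃) := by
  classical
  set p₂ : {e // e ∉ awayEdges ends a₁} → R := fun i => p i
  set X := fib ends a₁ (connEvent ends a₁ a₃) σ₁
  set W := fib ends a₁ (connEvent ends a₁ o) σ₁
  set Wγ : Set ({e // e ∉ awayEdges ends a₁} → Bool) :=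
    if Conn ends (baseConfig ends a₁ σ₁) a₃ o then Set.univ else W
  have hpt : ∀ τ, psiF ends a₁ p u a₃ o S b (glue (awayEdges ends a₁) σ₁ τ) =
      IpropF ends a₁ p u (cluster ends (baseConfig ends a₁ σ₁) a₃) *
        (S * (Xᶜ ∩ Wγ).indicator 1 τ - b * Xᶜ.indicator 1 τ) := fun τ => psiF_glue ends a₁ p u σ₁ τ a₃ o S b
  simp_rw [hpt]
  have hlin : expect p₂ (fun τ => IpropF ends a₁ p u (cluster ends (baseConfig ends a₁ σ₁) a₃) *
      (S * (Xᶜ ∩ Wγ).indicator 1 τ - b * Xᶜ.indicator 1 τ)) =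
      IpropF ends a₁ p u (cluster ends (baseConfig ends a₁ σ₁) a₃) *
        (S * prob p₂ (Xᶜ ∩ Wγ) - b * prob p₂ Xᶜ) := by
    rw [prob_eq_expect_indicator, prob_eq_expect_indicator]
    unfold expect
    rw [Finset.mul_sum, Finset.mul_sum, ← Finset.sum_sub_distrib, Finset.mul_sum]
    refine Finset.sum_congr rfl fun τ _ => ?_
    ring
  rw [hlin]
  have hm : prob p₂ (Xᶜ ∩ Wγ) = prob p₂ Xᶜ * mConst ends a₁ p σ₁ a₃ o := by
    by_cases hγ : Conn ends (baseConfig ends a₁ σ₁) a₃ o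
    · simp [Wγ, mConst, hγ]
    · have hW : Wγ = W := by simp [Wγ, hγ]
      have hm' : mConst ends a₁ p σ₁ a₃ o = prob p₂ W := by simp [mConst, hγ, p₂, W]
      rw [hW, hm']
      exact prob_inter_eq_mul_of_dependsOn p₂ (disjoint_into ends a₁ σ₁ h3 hγ)
        (dependsOn_compl (dependsOn_fib_conn ends a₁ σ₁ h3)) (dependsOn_fib_conn ends a₁ σ₁ ho)
  rw [hm]
  ring

/-- **Positivity of `E[Ψ]`** through `pa_given_avoid`. -/
lemma expect_psiF_nonneg (hp : IsProbVec p) {u : ({e // e ∉ awayEdges ends a₁} → Bool) → R}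
    (hu : Monotone u) (hu0 : ∀ τ, 0 ≤ u τ) (hu1 : ∀ τ, u τ ≤ 1) (a₃ o : V) :
    let e := connEvent ends a₁ a₃
    let L := connEvent ends a₁ o
    let γ := connEvent ends a₃ o
    0 ≤ expect p (psiF ends a₁ p u a₃ o (prob p (eᶜ ∩ Lᶜ)) (prob p (eᶜ ∩ Lᶜ ∩ γ))) := by
  intro e L γ
  classical
  set f := fIu ends a₁ p u with hf
  set S := prob p (eᶜ ∩ Lᶜ)
  set b := prob p (eᶜ ∩ Lᶜ ∩ γ)
  set d := prob p (eᶜ ∩ Lᶜ ∩ γᶜ)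
  have hSbd : S = b + d := (prob_inter_add_prob_inter_compl p (eᶜ ∩ Lᶜ) γ).symm
  have hd0 : 0 ≤ d := prob_nonneg hp _
  have hb0 : 0 ≤ b := prob_nonneg hp _
  -- the three pieces of `eᶜ`
  set EA := expect p (fun ω => f a₃ ω * (eᶜ ∩ L).indicator 1 ω)
  set EB := expect p (fun ω => f a₃ ω * (eᶜ ∩ Lᶜ ∩ γ).indicator 1 ω)
  set ED := expect p (fun ω => f a₃ ω * (eᶜ ∩ Lᶜ ∩ γᶜ).indicator 1 ω)
  have hf0 : ∀ v ω, 0 ≤ f v ω := fun v ω => IpropF_nonneg ends a₁ p hp hu _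
  have hEA : 0 ≤ EA := expect_nonneg hp fun ω => mul_nonneg (hf0 _ _)
    (Set.indicator_nonneg (fun _ _ => zero_le_one) ω)
  -- `E[Ψ] = S (EA + EB) − b (EA + EB + ED)`
  have hpsi : expect p (psiF ends a₁ p u a₃ o S b) = S * (EA + EB) - b * (EA + EB + ED) := by
    have hset1 : eᶜ ∩ (γ ∪ L) = (eᶜ ∩ L) ∪ (eᶜ ∩ Lᶜ ∩ γ) := by
      ext ω
      simp only [Set.mem_inter_iff, Set.mem_union, Set.mem_compl_iff]
      tauto
    have hset2 : eᶜ = (eᶜ ∩ L) ∪ ((eᶜ ∩ Lᶜ ∩ γ) ∪ (eᶜ ∩ Lᶜ ∩ γᶜ)) := by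
      ext ω
      simp only [Set.mem_inter_iff, Set.mem_union, Set.mem_compl_iff]
      tauto
    have hd1 : Disjoint (eᶜ ∩ L) (eᶜ ∩ Lᶜ ∩ γ) := by
      rw [Set.disjoint_left]
      rintro ω ⟨_, hL⟩ ⟨⟨_, hL'⟩, _⟩
      exact hL' hL
    have hd2 : Disjoint (eᶜ ∩ L) ((eᶜ ∩ Lᶜ ∩ γ) ∪ (eᶜ ∩ Lᶜ ∩ γᶜ)) := by
      rw [Set.disjoint_left]
      rintro ω ⟨_, hL⟩ (⟨⟨_, hL'⟩, _⟩ | ⟨⟨_, hL'⟩, _⟩) <;> exact hL' hL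
    have hd3 : Disjoint (eᶜ ∩ Lᶜ ∩ γ) (eᶜ ∩ Lᶜ ∩ γᶜ) := by
      rw [Set.disjoint_left]
      rintro ω ⟨_, hγ⟩ ⟨_, hγ'⟩
      exact hγ' hγ
    have hexp : expect p (psiF ends a₁ p u a₃ o S b) =
        S * expect p (fun ω => f a₃ ω * (eᶜ ∩ (γ ∪ L)).indicator 1 ω) -
          b * expect p (fun ω => f a₃ ω * eᶜ.indicator 1 ω) := by
      unfold expect
      rw [Finset.mul_sum, Finset.mul_sum, ← Finset.sum_sub_distrib]
      refine Finset.sum_congr rfl fun ω _ => ?_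
      simp only [psiF, hf]
      ring
    have hA : expect p (fun ω => f a₃ ω * (eᶜ ∩ (γ ∪ L)).indicator 1 ω) = EA + EB := by
      rw [hset1, expect_mul_indicator_union p _ hd1]
    have hB : expect p (fun ω => f a₃ ω * eᶜ.indicator 1 ω) = EA + (EB + ED) := by
      rw [hset2, expect_mul_indicator_union p _ hd2, expect_mul_indicator_union p _ hd3]
    rw [hexp, hA, hB]
    ring
  -- `pa_given_avoid` with `s = a₃`, `t = a₁`, `X = {a₃, o}`
  have hpa := CondAvoid.pa_given_avoid p hp ends a₃ a₁ (X := {a₃, o}) (by simp)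
    (isMonotoneClusterProperty_fIu ends a₁ p hp hu)
    (show IsMonotoneClusterProperty ends (connIndicator (R := R) ends o) from ?_)
    hf0 (fun v ω => Set.indicator_nonneg (fun _ _ => zero_le_one) ω)
    (fun ω => IpropF_le_one ends a₁ p hp hu0 hu1 _)
    (fun ω => by
      by_cases h : ω ∈ connEvent ends a₃ o <;> simp [connIndicator, h])
  swap
  · -- `connIndicator` is a monotone cluster property (as in `CondAvoidPA.lean`)
    refine ⟨fun w ω ξ h => ?_, fun w w' ω h => ?_⟩
    · simp only [connIndicator]
      by_cases hb : ω ∈ connEvent ends w o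
      · have : ξ ∈ connEvent ends w o := h hb
        rw [Set.indicator_of_mem hb, Set.indicator_of_mem this]
        exact le_rfl
      · rw [Set.indicator_of_notMem hb]
        exact Set.indicator_nonneg (fun _ _ => zero_le_one) ξ
    · simp only [connIndicator]
      have hc : Conn ends ω w w' := conn_of_openAdj h
      by_cases hb : ω ∈ connEvent ends w o
      · have : ω ∈ connEvent ends w' o := conn_trans (conn_symm hc) hb
        rw [Set.indicator_of_mem hb, Set.indicator_of_mem this]
      · have : ω ∉ connEvent ends w' o := fun h' => hb (conn_trans hc h')
        rw [Set.indicator_of_notMem hb, Set.indicator_of_notMem this]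
  rw [avoidEvent_eq] at hpa
  -- identify the four expectations of `hpa`
  have hD' : eᶜ ∩ Lᶜ = (eᶜ ∩ Lᶜ ∩ γ) ∪ (eᶜ ∩ Lᶜ ∩ γᶜ) := by
    ext ω
    simp only [Set.mem_inter_iff, Set.mem_union, Set.mem_compl_iff]
    tauto
  have hd3 : Disjoint (eᶜ ∩ Lᶜ ∩ γ) (eᶜ ∩ Lᶜ ∩ γᶜ) := by
    rw [Set.disjoint_left]
    rintro ω ⟨_, hγ⟩ ⟨_, hγ'⟩
    exact hγ' hγ
  have h1 : expect p (fun ω => f a₃ ω * (eᶜ ∩ Lᶜ).indicator 1 ω) = EB + ED := by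
    rw [hD', expect_mul_indicator_union p _ hd3]
  have h2 : expect p (fun ω => connIndicator (R := R) ends o a₃ ω * (eᶜ ∩ Lᶜ).indicator 1 ω) = b := by
    unfold connIndicator
    rw [expect_indicator_mul_indicator]
    congr 1
    ext ω
    simp only [Set.mem_inter_iff, Set.mem_compl_iff]
    tauto
  have hset3 : eᶜ ∩ Lᶜ ∩ γ = γ ∩ (eᶜ ∩ Lᶜ) := by
    ext ω
    simp only [Set.mem_inter_iff, Set.mem_compl_iff]
    tauto
  have h3 : expect p (fun ω => f a₃ ω * connIndicator (R := R) ends o a₃ ω * (eᶜ ∩ Lᶜ).indicator 1 ω)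
      = EB := by
    simp only [EB, connIndicator]
    unfold expect
    refine Finset.sum_congr rfl fun ω _ => ?_
    show weight p ω * (f a₃ ω * (connEvent ends a₃ o).indicator 1 ω * (eᶜ ∩ Lᶜ).indicator 1 ω) =
      weight p ω * (f a₃ ω * (eᶜ ∩ Lᶜ ∩ γ).indicator 1 ω)
    rw [hset3, indicator_inter_one γ (eᶜ ∩ Lᶜ) ω, mul_assoc]
  rw [h1, h2, h3] at hpa
  -- `hpa : (EB + ED) * b ≤ EB * S`; with `S = b + d` this is `ED * b ≤ EB * d`
  change (EB + ED) * b ≤ EB * S at hpa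
  rw [hpsi, hSbd]
  rw [hSbd] at hpa
  nlinarith [hpa, hEA, hd0, hb0]

/-- **`(ZC-direct)` for functions**: for every monotone observable `u` of the edges of `a₁` with
values in `[0, 1]`, lifted to `U = liftU u`, the (ZC) expression `P(D)·Cov(U, eL) − P(B)·Cov(U, e¬L)` is
nonnegative (MINE-A.md §83; the event form is `zc_direct`). -/
theorem zc_direct_fun (hp : IsProbVec p) {u : ({e // e ∉ awayEdges ends a₁} → Bool) → R}
    (hu : Monotone u) (hu0 : ∀ τ, 0 ≤ u τ) (hu1 : ∀ τ, u τ ≤ 1) {a₃ o : V}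
    (h3 : a₃ ≠ a₁) (ho : o ≠ a₁) :
    let U := liftU ends a₁ u
    let e := connEvent ends a₁ a₃
    let L := connEvent ends a₁ o
    let γ := connEvent ends a₃ o
    0 ≤ prob p (eᶜ ∩ Lᶜ ∩ γᶜ) *
          (expect p (fun ω => U ω * (e ∩ L).indicator 1 ω) - expect p U * prob p (e ∩ L)) -
      prob p (eᶜ ∩ Lᶜ ∩ γ) *
          (expect p (fun ω => U ω * (e ∩ Lᶜ).indicator 1 ω) - expect p U * prob p (e ∩ Lᶜ)) := by
  intro U e L γ
  classical
  set p₁ : {e // e ∈ awayEdges ends a₁} → R := fun i => p i with hp₁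
  set p₂ : {e // e ∉ awayEdges ends a₁} → R := fun i => p i with hp₂
  set S := prob p (eᶜ ∩ Lᶜ) with hS
  set b := prob p (eᶜ ∩ Lᶜ ∩ γ) with hb
  set d := prob p (eᶜ ∩ Lᶜ ∩ γᶜ) with hd
  have hSbd : S = b + d := (prob_inter_add_prob_inter_compl p (eᶜ ∩ Lᶜ) γ).symm
  have hS0 : 0 ≤ S := prob_nonneg hp _
  -- (1) the target as `S·Cov(U, eL) − b·Cov(U, e)`
  have hUe : expect p (fun ω => U ω * (e ∩ Lᶜ).indicator 1 ω) =
      expect p (fun ω => U ω * e.indicator 1 ω) - expect p (fun ω => U ω * (e ∩ L).indicator 1 ω) := by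
    have h1 : e = (e ∩ L) ∪ (e ∩ Lᶜ) := by
      ext ω; simp only [Set.mem_union, Set.mem_inter_iff, Set.mem_compl_iff]; tauto
    have h2 : Disjoint (e ∩ L) (e ∩ Lᶜ) := by
      rw [Set.disjoint_left]; rintro ω ⟨_, hL⟩ ⟨_, hL'⟩; exact hL' hL
    have := expect_mul_indicator_union p U h2
    rw [← h1] at this
    linarith
  have he : prob p (e ∩ Lᶜ) = prob p e - prob p (e ∩ L) := by
    have := prob_inter_add_prob_inter_compl p e L
    linarith
  rw [hUe, he]
  have hrew : d * (expect p (fun ω => U ω * (e ∩ L).indicator 1 ω) - expect p U * prob p (e ∩ L)) -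
      b * (expect p (fun ω => U ω * e.indicator 1 ω) -
          expect p (fun ω => U ω * (e ∩ L).indicator 1 ω) -
        expect p U * (prob p e - prob p (e ∩ L))) =
      S * (expect p (fun ω => U ω * (e ∩ L).indicator 1 ω) - expect p U * prob p (e ∩ L)) -
        b * (expect p (fun ω => U ω * e.indicator 1 ω) - expect p U * prob p e) := by
    rw [hSbd]; ring
  rw [hrew]
  -- (2) the tower
  have hPU : expect p U = expect p₂ u := expect_liftU ends a₁ p u
  have hfibeL : ∀ σ₁ : {e // e ∈ awayEdges ends a₁} → Bool, fib ends a₁ (e ∩ L) σ₁ =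
      fib ends a₁ e σ₁ ∩ fib ends a₁ L σ₁ := fun _ => rfl
  have htower : S * (expect p (fun ω => U ω * (e ∩ L).indicator 1 ω) - expect p U * prob p (e ∩ L)) -
      b * (expect p (fun ω => U ω * e.indicator 1 ω) - expect p U * prob p e) =
      ∑ σ₁ : {e // e ∈ awayEdges ends a₁} → Bool, weight p₁ σ₁ *
        (S * (expect p₂ (fun τ => u τ * (fib ends a₁ e σ₁ ∩ fib ends a₁ L σ₁).indicator 1 τ) -
            expect p₂ u * prob p₂ (fib ends a₁ e σ₁ ∩ fib ends a₁ L σ₁)) -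
          b * (expect p₂ (fun τ => u τ * (fib ends a₁ e σ₁).indicator 1 τ) -
            expect p₂ u * prob p₂ (fib ends a₁ e σ₁))) := by
    rw [expect_liftU_mul_indicator ends a₁ p u (e ∩ L), prob_eq_sum_fib ends a₁ p (e ∩ L),
      expect_liftU_mul_indicator ends a₁ p u e, prob_eq_sum_fib ends a₁ p e, hPU]
    simp only [hfibeL]
    rw [Finset.mul_sum Finset.univ _ (expect p₂ u), Finset.mul_sum Finset.univ _ (expect p₂ u),
      ← Finset.sum_sub_distrib, ← Finset.sum_sub_distrib, Finset.mul_sum Finset.univ _ S,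
      Finset.mul_sum Finset.univ _ b, ← Finset.sum_sub_distrib]
    refine Finset.sum_congr rfl fun σ₁ _ => ?_
    ring
  rw [htower]
  -- (3) the fibre step and the identification with `Ψ`
  have hp₁' : IsProbVec p₁ := ⟨fun i => hp.nonneg i, fun i => hp.le_one i⟩
  have hw₁ : ∀ σ₁, 0 ≤ weight p₁ σ₁ := fun σ₁ => weight_nonneg hp₁' σ₁
  have hpsi : ∀ σ₁ : {e // e ∈ awayEdges ends a₁} → Bool,
      expect p₂ (fun τ => psiF ends a₁ p u a₃ o S b (glue (awayEdges ends a₁) σ₁ τ)) ≤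
        S * (expect p₂ (fun τ => u τ * (fib ends a₁ e σ₁ ∩ fib ends a₁ L σ₁).indicator 1 τ) -
            expect p₂ u * prob p₂ (fib ends a₁ e σ₁ ∩ fib ends a₁ L σ₁)) -
          b * (expect p₂ (fun τ => u τ * (fib ends a₁ e σ₁).indicator 1 τ) -
            expect p₂ u * prob p₂ (fib ends a₁ e σ₁)) := by
    intro σ₁
    rw [expect_psiF_fibre ends a₁ p u σ₁ h3 ho S b, mul_assoc, ← fib_cov_eq_fun ends a₁ p u σ₁ h3]
    exact fibre_step_fun ends a₁ p hp hu hu0 σ₁ h3 ho hS0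
  have hsum : expect p (psiF ends a₁ p u a₃ o S b) ≤
      ∑ σ₁ : {e // e ∈ awayEdges ends a₁} → Bool, weight p₁ σ₁ *
        (S * (expect p₂ (fun τ => u τ * (fib ends a₁ e σ₁ ∩ fib ends a₁ L σ₁).indicator 1 τ) -
            expect p₂ u * prob p₂ (fib ends a₁ e σ₁ ∩ fib ends a₁ L σ₁)) -
          b * (expect p₂ (fun τ => u τ * (fib ends a₁ e σ₁).indicator 1 τ) -
            expect p₂ u * prob p₂ (fib ends a₁ e σ₁))) := by
    rw [expect_eq_sum_fib ends a₁ p]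
    exact Finset.sum_le_sum fun σ₁ _ => mul_le_mul_of_nonneg_left (hpsi σ₁) (hw₁ σ₁)
  exact le_trans (expect_psiF_nonneg ends a₁ p hp hu hu0 hu1 a₃ o) hsum

end AssemblyFun

end ZCDirect

end Summit.Ventures.PercRepro2
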